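import Summits.RiemannHypothesis.RiemannHypothesis.Theorems.HandoffLossyCoupling
import Literature.NumberTheory.LFunctions.RiemannXiProofs
import HarnessLib

/-!
# `WeilBottomBoundedCriterion` ⟺ «an off-line zero makes the window bottom unbounded below» (the Lemma-L shape), and what RH then IS

Cell `rh-explicit`, TRACK «HANDOFF», seat handoff-theory-1 (definitions + logic), gen3.  Companion text:
`HOME/handoff/HANDOFF-STATEMENT.md` §J.4/§J.9; idea-1 gen5 `HOME/handoff/idea-1/WEIL-BOTTOM-UNBOUNDED.md` (LEMMA L, PROVED ON PAPER, prime side +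
Landau's lemma, MV2007 Thm 15.2's method; checked line by line by this seat, see §J.9) and idea-2 gen4 L10′ (the same claim, zero side).  Builds on
`HandoffLossyCoupling.lean` (this seat: `WeilBottomBoundedCriterion`) and the tree's `RiemannXiProofs.lean` (`riemannXi_eq_zero_of_nontrivial`,
`riemannXi_eq_zero_iff_holds`, `riemannXi_one_sub`: a non-trivial off-line zero yields a zero with `½ < Re ρ < 1`).

HONEST FRAMING.  Nothing here is a step towards RH, and LEMMA L itself is NOT proved here (it is the analytic input, stated as the `Prop`
`WeilBottomDropOfOffLineZero` — exactly the shape idea-1 suggests for the tree, `riemannZeta ρ = 0 → 1/2 < ρ.re → ρ.re < 1 → ∀ C, ∃ t > 0, ε t < −C`).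
What IS proved is the bookkeeping that makes it the RIGHT input:
* `weilBottomBoundedCriterion_iff_dropOfOffLineZero` — the open criterion of `HandoffLossyCoupling.lean` is EQUIVALENT to the Lemma-L shape
  (⇐: from `¬RH` Mathlib's definition gives a non-trivial zero off the line, `ξ(1−s) = ξ(s)` reflects it into `½ < Re < 1`; ⇒: a zero with
  `½ < Re < 1` refutes RH, and the criterion's contrapositive is unboundedness);
* `riemannHypothesis_iff_bddBelow_of_dropOfOffLineZero` — GRANTED Lemma L: `RH ↔ ∃ C, ∀ t > 0, −C ≤ ε(t)` («RH is: the Weil window bottom is bounded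
  below»), and `riemannHypothesis_iff_eventually_ge_of_dropOfOffLineZero`: `RH ↔ ∃ C T, ∀ t ≥ T, −C ≤ ε(t)` (only the TAIL of the windows matters; ε is antitone).
So once LEMMA L is kernel-checked (idea-1 §3.2′: the Landau engine is already in the tree, `NicolasOmega.lean` pattern), every CONDITIONAL theorem of the
lossy tier (`riemannHypothesis_of_forall_handoffCouplingReg_const`, `riemannHypothesis_of_bounded_loss`) becomes unconditional in its bridge.

References: Montgomery–Vaughan 2007, Lemma 15.1 / Thm 15.2 (Landau) [MontgomeryVaughan2007]; Titchmarsh §2.12 (ξ) [Titchmarsh1986]; this track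
HANDOFF-STATEMENT §J, idea-1 WEIL-BOTTOM-UNBOUNDED.md, idea-2 L10′.
-/

set_option linter.dupNamespace false  -- the mandated namespace repeats `RiemannHypothesis`

noncomputable section

open Set Literature.NumberTheory.LFunctions

namespace Summit.RiemannHypothesis.RiemannHypothesis.Theorems.HandoffDecomposition

/-- **LEMMA L, as a `Prop` (the analytic input; PROVED ON PAPER by idea-1 gen5 / claimed by idea-2 gen4 L10′; NOT yet in the tree)**: every zero of
`ζ` with `½ < Re ρ < 1` makes the window bottom `ε = weilGroundEnergy` unbounded below.  (Paper proof: for the symmetric bump pair `g = (h(·−u₀/2) +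
h(·+u₀/2))/√2`, `Re Q(g) = C_φ − E_φ(e^{u₀}) + o(1)` with `E_φ(x) = Σ Λ(n)n^{−1/2}φ(log(n/x)) − x^{1/2}Φ(½)` a smoothed Chebyshev remainder, and Landau's
lemma gives `E_φ(x_k) > x_k^{Re ρ − ½ − η}` along `x_k → ∞`.)  A statement of THIS track pending kernel-check, not a literature fact.
[this track: idea-1 WEIL-BOTTOM-UNBOUNDED.md (paper), MontgomeryVaughan2007 Thm. 15.2 (method)] -/
def WeilBottomDropOfOffLineZero : Prop :=
  ∀ ρ : ℂ, riemannZeta ρ = 0 → 1 / 2 < ρ.re → ρ.re < 1 → ∀ C : ℝ, ∃ t : ℝ, 0 < t ∧ weilGroundEnergy t < -C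

/-- From `¬RH` (Mathlib's statement): a zero of `ζ` with `½ < Re ρ < 1` (reflect by `ξ(1−s) = ξ(s)` if the off-line zero lies left of the line).
The opening lines of the tree's `Nicolas.exists_zero_right_of_not_RH`, isolated. [cite: Titchmarsh1986, §2.12; folklore] -/
theorem exists_zero_re_gt_half_of_not_riemannHypothesis (hRH : ¬ Summit.RiemannHypothesis) :
    ∃ ρ : ℂ, riemannZeta ρ = 0 ∧ 1 / 2 < ρ.re ∧ ρ.re < 1 := by
  obtain ⟨s, hs, htriv, hs1, hsre⟩ : ∃ s : ℂ, riemannZeta s = 0 ∧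
      (¬∃ n : ℕ, s = -2 * (n + 1)) ∧ s ≠ 1 ∧ s.re ≠ 1 / 2 := by
    by_contra hcon
    refine hRH fun s hs htriv hs1 ↦ ?_
    by_contra hre
    exact hcon ⟨s, hs, htriv, hs1, hre⟩
  have hxi := riemannXi_eq_zero_of_nontrivial hs htriv hs1
  obtain ⟨hz, h0, h1⟩ := (riemannXi_eq_zero_iff_holds s).1 hxi
  rcases lt_or_gt_of_ne hsre with hlt | hgt
  · refine ⟨1 - s, ?_, ?_, ?_⟩
    · have hxi' : riemannXi (1 - s) = 0 := by rwa [riemannXi_one_sub]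
      exact ((riemannXi_eq_zero_iff_holds (1 - s)).1 hxi').1
    · simp only [Complex.sub_re, Complex.one_re]; linarith
    · simp only [Complex.sub_re, Complex.one_re]; linarith
  · exact ⟨s, hz, hgt, h1⟩

/-- A zero with `½ < Re ρ < 1` refutes RH (it is non-trivial and `≠ 1`). [folklore] -/
theorem not_riemannHypothesis_of_zero {ρ : ℂ} (hρ : riemannZeta ρ = 0) (h1 : 1 / 2 < ρ.re) (h2 : ρ.re < 1) :
    ¬ Summit.RiemannHypothesis := by
  intro hRH
  have htriv : ¬∃ n : ℕ, ρ = -2 * (n + 1) := by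
    rintro ⟨n, hn⟩
    have := congrArg Complex.re hn
    simp at this
    have hn0 : (0 : ℝ) ≤ n := n.cast_nonneg
    linarith
  have hne : ρ ≠ 1 := by
    rintro rfl
    simp at h2
  have := hRH ρ hρ htriv hne
  linarith

/-- **The open criterion IS the Lemma-L shape**: `WeilBottomBoundedCriterion ↔ WeilBottomDropOfOffLineZero`. [this track (theory-1 gen3)] -/
theorem weilBottomBoundedCriterion_iff_dropOfOffLineZero :
    WeilBottomBoundedCriterion ↔ WeilBottomDropOfOffLineZero := by
  constructor
  · intro hcrit ρ hρ h1 h2 C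
    by_contra hnone
    push Not at hnone
    -- `ε ≥ −C` on every window would give RH, contradicting the zero
    exact not_riemannHypothesis_of_zero hρ h1 h2 (hcrit ⟨C, fun t ht ↦ hnone t ht⟩)
  · rintro hL ⟨C, hC⟩
    by_contra hRH
    obtain ⟨ρ, hρ, h1, h2⟩ := exists_zero_re_gt_half_of_not_riemannHypothesis hRH
    obtain ⟨t, ht, hlt⟩ := hL ρ hρ h1 h2 C
    linarith [hC t ht]

/-- **GRANTED LEMMA L: `RH ↔` the window bottom is bounded below.** [this track (theory-1 gen3); idea-1 WEIL-BOTTOM-UNBOUNDED.md Cor. 1 (paper)] -/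
theorem riemannHypothesis_iff_bddBelow_of_dropOfOffLineZero (hL : WeilBottomDropOfOffLineZero) :
    Summit.RiemannHypothesis ↔ ∃ C : ℝ, ∀ t : ℝ, 0 < t → -C ≤ weilGroundEnergy t :=
  weilBottomBoundedCriterion_iff.1 (weilBottomBoundedCriterion_iff_dropOfOffLineZero.2 hL)

/-- **GRANTED LEMMA L: only the TAIL matters** — `RH ↔ ∃ C T, ∀ t ≥ T, −C ≤ ε(t)` (`ε` is antitone on `(0, ∞)`, so a bound on all large
windows bounds every window). This is the form the summable-loss handoff targets of `HandoffLossyStep.lean` feed. [this track (theory-1 gen3)] -/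
theorem riemannHypothesis_iff_eventually_ge_of_dropOfOffLineZero (hL : WeilBottomDropOfOffLineZero) :
    Summit.RiemannHypothesis ↔ ∃ C T : ℝ, ∀ t : ℝ, T ≤ t → -C ≤ weilGroundEnergy t := by
  rw [riemannHypothesis_iff_bddBelow_of_dropOfOffLineZero hL]
  constructor
  · rintro ⟨C, hC⟩
    exact ⟨C, 1, fun t ht ↦ hC t (lt_of_lt_of_le one_pos ht)⟩
  · rintro ⟨C, T, hCT⟩
    refine ⟨C, fun t ht ↦ ?_⟩
    rcases le_or_gt T t with hTt | htT
    · exact hCT t hTt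
    · -- `t < T`: use the window `max T t ≥ T` and antitonicity
      exact (hCT (max T t) (le_max_left _ _)).trans (weilGroundEnergy_anti ht (le_max_right _ _))

end Summit.RiemannHypothesis.RiemannHypothesis.Theorems.HandoffDecomposition

end
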